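import Literature.Analysis.FluidPDE.KatoLaiPhysicalVelocity
import Literature.Analysis.FluidPDE.KatoLaiLevelPath
import HarnessLib

/-!
# Kato–Lai in the periodic cylinder: identification of the acceleration on the cell

Analysis/FluidPDE support file for the energy-method construction of Euler flows in the
periodic cylinder (`Literature.Analysis.FluidPDE.KatoLai1984_periodicCylinderUniformExistence`;
Kato–Lai 1984, §5 p. 23 and §6). Along a windowed coefficient path `G` whose cell restriction
`V = R ∘ G` is a cell path (`KatoLaiRestart.IsCellPath`), the `L²`-level acceleration
`pathAcc G t` (`KatoLaiPhysicalVelocity`) is a limit object; this file identifies its physical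
field on the closed cylinder with Kato–Lai's `A(u) = (Pu·∇_K)u − ∇_K π` of the (smooth) velocity
`u = pathVel G t`, by **Kato–Lai's restart argument**: the solution of Theorem A started from the
smooth datum `u(t)` has the same cell path (uniqueness of cell paths, `IsCellPath.eq`), and its
right derivative at the restart time is computed by the smooth calculus
(`klOpExt_toSym`, `fromTorus_klOp_eq`).

* `IsCellPath.mono`, `IsCellPath.shift`, `isCellPath_velCell` — bookkeeping of cell paths;
* `lerayPart_eqOn_of_helmholtzProj_eq_zero` — a smooth periodic field without gradient part is its
  own Leray part on the closed cylinder; hence divergence free and tangential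
  (`divergence_eq_zero_of_helmholtzProj_eq_zero`, `slip_of_helmholtzProj_eq_zero`);
* `IsWindowed.hasDerivWithinAt_cellRestrict` — `dₜ R(G t) = −R(pathAcc G t)` within `[0, T]`;
* `IsWindowed.eqOn_physVel_pathAcc_klOp` — **the identification**: if `u(t) = pathVel G t` is
  smooth on the closed cylinder then `fromTorus (physVel (pathAcc G t)) = fromTorus (klOp (torusRep u(t)))`
  on the closed cylinder;
* `IsWindowed.physVel_pathAcc_eq_convect_sub_pressureGrad` — consequently, in the open cylinder,
  `fromTorus (physVel (pathAcc G t)) x = (u·∇)u (x) − ∇_K π (x)` with `π` the Kato–Lai pressure of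
  `u(t)` (**the Euler equation** for `∂ₜu = −fromTorus (physVel (pathAcc G t))`).

Everything is proved; no named fact and no `sorry` is introduced.

## References

* T. Kato, C. Y. Lai, J. Funct. Anal. 56 (1984) 15–28, §5 (5.6), p. 23, §6. [KatoLai1984]
-/

noncomputable section

open MeasureTheory Set Function Filter Topology TopologicalSpace
open scoped NNReal ENNReal InnerProductSpace RealInnerProductSpace ContDiff

namespace Literature.Analysis.FluidPDE

open FunctionSpaces FunctionSpaces.Torus UnitAddTorus

/-- Local notation for physical space `ℝ³ = EuclideanSpace ℝ (Fin 3)`. -/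
local notation "ℝ³" => EuclideanSpace ℝ (Fin 3)

/-- Local notation for the closed cylinder `{r ≤ 1}`. -/
local notation "𝕂" => closure (SetLike.coe unitCylinder : Set (EuclideanSpace ℝ (Fin 3)))

namespace PeriodicCylinder

variable {L : ℝ} (hL : 0 < L)

/-! ### Bookkeeping of cell paths -/

section CellPath

/-- Restriction of a cell path to a shorter interval. [folklore] -/
theorem IsCellPath.mono {ρ T T' : ℝ} {V : ℝ → Lp ℝ³ 2 (cellMeasure L)} (h : IsCellPath hL ρ T V) (hT' : T' ≤ T) :
    IsCellPath hL ρ T' V where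
  continuousOn := h.continuousOn.mono (Icc_subset_Icc le_rfl hT')
  grad_free := fun t ht => h.grad_free t ⟨ht.1, ht.2.trans hT'⟩
  deriv := fun t ht => h.deriv t ⟨ht.1, ht.2.trans_le hT'⟩

/-- Time shift of a cell path. [folklore] -/
theorem IsCellPath.shift {ρ T : ℝ} {V : ℝ → Lp ℝ³ 2 (cellMeasure L)} (h : IsCellPath hL ρ T V) {t₀ : ℝ} (ht₀ : 0 ≤ t₀) :
    IsCellPath hL ρ (T - t₀) (fun τ => V (t₀ + τ)) where
  continuousOn := h.continuousOn.comp (continuous_const.add continuous_id).continuousOn fun τ hτ =>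
    ⟨by linarith [hτ.1], by linarith [hτ.2]⟩
  grad_free := fun τ hτ => h.grad_free (t₀ + τ) ⟨by linarith [hτ.1], by linarith [hτ.2]⟩
  deriv := fun τ hτ => by
    obtain ⟨s, ε, f, hf, hV, hd⟩ := h.deriv (t₀ + τ) ⟨by linarith [hτ.1], by linarith [hτ.2]⟩
    refine ⟨s, ε, f, hf, hV, ?_⟩
    have hsh : HasDerivWithinAt (fun τ' : ℝ => t₀ + τ') 1 (Ici τ) τ := ((hasDerivAt_id τ).const_add t₀).hasDerivWithinAt
    have hmaps : MapsTo (fun τ' : ℝ => t₀ + τ') (Ici τ) (Ici (t₀ + τ)) := fun τ' hτ' => by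
      simp only [mem_Ici] at hτ' ⊢; linarith
    have := hd.scomp τ hsh hmaps
    rw [one_smul] at this
    exact this

/-- **A solution in duality form from a gradient-free datum gives a cell path** on `[0, T]`, with
bound any `ρ` dominating `‖u τ‖`. [cite: KatoLai1984, §5 (pp. 22–23)] -/
theorem isCellPath_velCell (s : ℕ) (ε : ℝ) {φ : SymL2 (Fin 3)} {T : ℝ} {u : ℝ → SymL2 (Fin 3)}
    (hu : KatoLai.IsFormSolution (embed s ε) (klForm hL s ε) φ T u) (hT : 0 ≤ T) {ρ : ℝ} (hρ : ∀ τ ∈ Icc 0 T, ‖u τ‖ ≤ ρ)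
    (hQ : helmholtzProj L (velCell hL s ε u 0) = 0) : IsCellPath hL ρ T (velCell hL s ε u) where
  continuousOn := fun _ hτ => (hasDerivWithinAt_velCell hL s ε hu hT hτ).continuousWithinAt
  grad_free := fun _ hτ => helmholtzProj_velCell_eq_zero hL s ε hu hT hQ hτ
  deriv := fun τ hτ => ⟨s, ε, u τ, hρ τ ⟨hτ.1, hτ.2.le⟩, rfl,
    (hasDerivWithinAt_velCell hL s ε hu hT ⟨hτ.1, hτ.2.le⟩).mono_of_mem_nhdsWithin
      (mem_of_superset (Icc_mem_nhdsGE hτ.2) (Icc_subset_Icc hτ.1 le_rfl))⟩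

end CellPath

/-! ### Gradient-free smooth fields -/

section Leray

variable {u : ℝ³ → ℝ³} (hu : IsSmoothPeriodic L u)
include hL hu

/-- **A smooth periodic field without gradient part is its own Leray part** on the closed
cylinder. [cite: KatoLai1984, §4 (i)] -/
theorem lerayPart_eqOn_of_helmholtzProj_eq_zero (hQ : helmholtzProj L (toCell L u) = 0) : EqOn (lerayPart hL hu) u 𝕂 := by
  have hg : IsSmoothPeriodic L (cylGrad (lerayPot hL hu)) := (isSmoothPeriodic_lerayPot hL hu).cylGrad
  have h0 : toCell L (cylGrad (lerayPot hL hu)) = toCell L (fun _ : ℝ³ => (0 : ℝ³)) := by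
    rw [← (lerayPot_spec hL hu).2.1, hQ, toCell_zero]
  have hz : EqOn (cylGrad (lerayPot hL hu)) (fun _ => (0 : ℝ³)) 𝕂 :=
    eqOn_closure_of_toCell_eq hL hg.continuousOn continuousOn_const hg.periodic (fun _ => rfl) h0
  intro x hx
  show u x - cylGrad (lerayPot hL hu) x = u x
  rw [hz hx, sub_zero]

/-- Such a field is divergence free in the open cylinder … [folklore] -/
theorem divergence_eq_zero_of_helmholtzProj_eq_zero (hQ : helmholtzProj L (toCell L u) = 0) :
    ∀ x ∈ (unitCylinder : Set ℝ³), VectorCalculus.divergence u x = 0 := by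
  intro x hx
  have he : lerayPart hL hu =ᶠ[𝓝 x] u := by
    filter_upwards [unitCylinder.isOpen.mem_nhds hx] with y hy
    exact lerayPart_eqOn_of_helmholtzProj_eq_zero hL hu hQ (subset_closure hy)
  have h := divergence_lerayPart hL hu x hx
  simp only [VectorCalculus.divergence, he.fderiv_eq] at h
  simpa only [VectorCalculus.divergence] using h

/-- … and tangential on the wall. [folklore] -/
theorem slip_of_helmholtzProj_eq_zero (hQ : helmholtzProj L (toCell L u) = 0) :
    ∀ x ∈ frontier (unitCylinder : Set ℝ³), ⟪u x, eR x⟫_ℝ = 0 := by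
  intro x hx
  have h := slip_lerayPart hL hu x hx
  rwa [lerayPart_eqOn_of_helmholtzProj_eq_zero hL hu hQ (frontier_subset_closure hx)] at h

end Leray

/-! ### The identification -/

section Ident

variable {hL} {s : ℕ} {δ T : ℝ} {G : ℝ → SymL2 (Fin 3)} (hW : IsWindowed hL s δ T G)
include hW

/-- **The cell restriction of a windowed path is differentiable within `[0, T]`** with derivative
`−R(pathAcc G t)` (`s ≥ 6`). [cite: KatoLai1984, §5 (p. 22)] -/
theorem IsWindowed.hasDerivWithinAt_cellRestrict (hs : 6 ≤ s) {t : ℝ} (ht : t ∈ Icc 0 T) :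
    HasDerivWithinAt (fun τ => cellRestrict hL (G τ)) (-cellRestrict hL (pathAcc hL G t)) (Icc 0 T) t := by
  have hs1 : 1 ≤ s := by omega
  have hd := hW.hasDerivWithinAt_levRead (show 2 ≤ 4 by norm_num) (by omega : 4 + 1 < s) ht
  have h2 := ((cellRestrict hL).comp (drop 4)).hasFDerivAt.comp_hasDerivWithinAt t hd
  have hval : ((cellRestrict hL).comp (drop 4)) (-bilExt hL (show 2 ≤ 4 by norm_num) (levRead (4 + 1) (G t)) (levRead (4 + 1) (G t))) =
      -cellRestrict hL (pathAcc hL G t) := by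
    rw [map_neg]; rfl
  rw [hval] at h2
  have hrepr : ∀ τ ∈ Icc 0 T, cellRestrict hL (G τ) = ((cellRestrict hL).comp (drop 4)) (levRead 4 (G τ)) := fun τ hτ => by
    rw [ContinuousLinearMap.comp_apply, drop_eq_of_atLevel (hW.atLevel_levRead hs1 (by omega) hτ)]
  exact h2.congr (fun τ hτ => hrepr τ hτ) (hrepr t ht)

/-- The cell restriction of `G t` is the class of the velocity. [folklore] -/
theorem IsWindowed.cellRestrict_eq_toCell_pathVel (hs : 2 ≤ s) {t : ℝ} (ht : t ∈ Icc 0 T) :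
    cellRestrict hL (G t) = toCell L (pathVel L G t) :=
  (hW.atLevel_levRead (by omega) hs ht).cellRestrict_eq_toCell hL le_rfl

/-- **Kato–Lai's restart identification.** Along a windowed path (`s ≥ 6`) whose cell restriction
is a cell path, at every `t ∈ [0, T)` at which the velocity `u(t) = pathVel G t` is smooth on the
closed cylinder, the physical field of the acceleration is Kato–Lai's `A(u(t))` read through the
torus representative: `fromTorus (physVel (pathAcc G t)) = fromTorus (klOp (torusRep u(t)))` on the
closed cylinder. [cite: KatoLai1984, §5 (p. 23), §6 (proof of Thm II)] -/
theorem IsWindowed.eqOn_physVel_pathAcc_klOp (hs : 6 ≤ s) {ρ : ℝ} (hP : IsCellPath hL ρ T fun t => cellRestrict hL (G t))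
    {t : ℝ} (ht : t ∈ Ico 0 T) (hv : IsSmoothPeriodic L (pathVel L G t)) :
    EqOn (fromTorus L (physVel (pathAcc hL G t))) (fromTorus L (klOp L hL (isSmooth_torusRep hv))) 𝕂 := by
  have hs3 : 3 ≤ s := by omega
  have ht' : t ∈ Icc 0 T := ⟨ht.1, ht.2.le⟩
  set V : ℝ → Lp ℝ³ 2 (cellMeasure L) := fun τ => cellRestrict hL (G τ) with hVdef
  -- the smooth competitor
  set U : UnitAddTorus (Fin 3) → ℝ³ := torusRep L (pathVel L G t) with hUdef
  have hU : IsSmooth U := isSmooth_torusRep hv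
  set f₁ : SymL2 (Fin 3) := toSym s 1 hU with hf₁
  set M' : ℝ := ‖f₁‖ ^ 2 with hM'
  obtain ⟨u, hu, hub⟩ := runK_spec hL hs3 1 M' (sq_nonneg _) f₁ le_rfl
  set δ₁ : ℝ := (2 * runK hL hs3 * (M' + 2) ^ 2 + 1)⁻¹ with hδ₁
  have hδ₁pos : 0 < δ₁ := by rw [hδ₁]; have := runK_nonneg hL hs3; positivity
  -- its cell path starts at `V t`
  have hV0 : velCell hL s 1 u 0 = V t := by
    rw [velCell, klVel, hu.initial, hf₁, embed_toSym, cellRestrict_toL2, cellOf, hVdef]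
    simp only
    rw [hW.cellRestrict_eq_toCell_pathVel (by omega) ht']
    refine toCell_congr fun x hx => ?_
    exact fromTorus_torusRep_of_mem_K hL hv.periodic (subset_closure (cylinderCell_le_unitCylinder L hx))
  have hQ : helmholtzProj L (velCell hL s 1 u 0) = 0 := by rw [hV0]; exact hP.grad_free t ht'
  have hρ₁ : ∀ τ ∈ Icc 0 δ₁, ‖u τ‖ ≤ Real.sqrt (M' + 1) := fun τ hτ =>
    (le_abs_self _).trans (Real.abs_le_sqrt (hub τ hτ))
  have hP₁ : IsCellPath hL (Real.sqrt (M' + 1)) δ₁ (velCell hL s 1 u) := isCellPath_velCell hL s 1 hu hδ₁pos.le hρ₁ hQ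
  -- the shifted original path, and the common interval
  have hP₂ : IsCellPath hL ρ (T - t) (fun τ => V (t + τ)) := IsCellPath.shift hL hP ht.1
  set T₁ : ℝ := min (T - t) δ₁ with hT₁
  have hT₁pos : 0 < T₁ := lt_min (by linarith [ht.2]) hδ₁pos
  have hEq := IsCellPath.eq hL (IsCellPath.mono hL hP₂ (min_le_left _ _)) (IsCellPath.mono hL hP₁ (min_le_right _ _))
    (by simp only [add_zero]; exact hV0.symm)
  -- right derivative of the competitor at `0`: the smooth calculus
  have hd₁ : HasDerivWithinAt (velCell hL s 1 u) (-cellRestrict hL (klOpExt hL s 1 f₁)) (Icc 0 δ₁) 0 := by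
    have := hasDerivWithinAt_velCell hL s 1 hu hδ₁pos.le (t := 0) ⟨le_rfl, hδ₁pos.le⟩
    rwa [hu.initial] at this
  have hklOp : cellRestrict hL (klOpExt hL s 1 f₁) = toCell L (fromTorus L (klOp L hL hU)) := by
    rw [hf₁, klOpExt_toSym hL s 1 hU, cellRestrict_toL2]; rfl
  -- right derivative of the original at `t`, shifted to `0`
  have hd₂ : HasDerivWithinAt (fun τ => V (t + τ)) (-cellRestrict hL (pathAcc hL G t)) (Icc 0 (T - t)) 0 := by
    have hd' : HasDerivWithinAt V (-cellRestrict hL (pathAcc hL G t)) (Icc 0 T) (t + 0) := by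
      rw [add_zero]; exact hW.hasDerivWithinAt_cellRestrict hs ht'
    have hsh : HasDerivWithinAt (fun τ : ℝ => t + τ) 1 (Icc 0 (T - t)) 0 := ((hasDerivAt_id (0 : ℝ)).const_add t).hasDerivWithinAt
    have hmaps : MapsTo (fun τ : ℝ => t + τ) (Icc 0 (T - t)) (Icc 0 T) := fun τ hτ => ⟨by linarith [hτ.1, ht.1], by linarith [hτ.2]⟩
    have := hd'.scomp (0 : ℝ) hsh hmaps
    rw [one_smul] at this
    exact this
  -- both within `[0, T₁]`, along the same path: uniqueness of the derivative
  have hd₁' : HasDerivWithinAt (velCell hL s 1 u) (-cellRestrict hL (klOpExt hL s 1 f₁)) (Icc 0 T₁) 0 :=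
    hd₁.mono (Icc_subset_Icc le_rfl (min_le_right _ _))
  have hd₂' : HasDerivWithinAt (velCell hL s 1 u) (-cellRestrict hL (pathAcc hL G t)) (Icc 0 T₁) 0 := by
    refine (hd₂.mono (Icc_subset_Icc le_rfl (min_le_left _ _))).congr (fun τ hτ => (hEq τ hτ).symm) ?_
    have h0 := hEq 0 ⟨le_rfl, hT₁pos.le⟩
    exact h0.symm
  have huniq : -cellRestrict hL (klOpExt hL s 1 f₁) = -cellRestrict hL (pathAcc hL G t) :=
    (uniqueDiffOn_Icc hT₁pos 0 ⟨le_rfl, hT₁pos.le⟩).eq_deriv _ hd₁' hd₂'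
  have hR : toCell L (fromTorus L (physVel (pathAcc hL G t))) = toCell L (fromTorus L (klOp L hL hU)) := by
    rw [← (atLevel_pathAcc hL G t).cellRestrict_eq_toCell hL (by norm_num), ← hklOp]
    exact (neg_injective huniq).symm
  -- conclude on the closed cylinder
  exact eqOn_closure_of_toCell_eq hL ((atLevel_pathAcc hL G t).continuous_fromTorus_physVel (by norm_num) L).continuousOn
    (contDiff_fromTorus L (isSmooth_klOp hL hU)).continuous.continuousOn (isAxiallyPeriodic_fromTorus hL.ne' _)
    (isAxiallyPeriodic_fromTorus hL.ne' _) hR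

/-- **The Euler equation in the open cylinder.** Under the hypotheses of
`IsWindowed.eqOn_physVel_pathAcc_klOp`, for `x` in the open cylinder
`fromTorus (physVel (pathAcc G t)) x = (u(t)·∇)u(t) (x) − ∇_K π (x)`, where `π` is the Kato–Lai
pressure of `u(t)` (the velocity has no gradient part, so `P u(t) = u(t)`).
[cite: KatoLai1984, §5 (5.6), Thm I] -/
theorem IsWindowed.physVel_pathAcc_eq_convect_sub_pressureGrad (hs : 6 ≤ s) {ρ : ℝ}
    (hP : IsCellPath hL ρ T fun t => cellRestrict hL (G t)) {t : ℝ} (ht : t ∈ Ico 0 T) (hv : IsSmoothPeriodic L (pathVel L G t))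
    {x : ℝ³} (hx : x ∈ (unitCylinder : Set ℝ³)) :
    fromTorus L (physVel (pathAcc hL G t)) x =
      convect (pathVel L G t) (pathVel L G t) x -
        pressureGrad hL (isSmoothPeriodic_fromTorus hL.ne' (isSmooth_torusRep hv)) x := by
  have hxK : x ∈ 𝕂 := subset_closure hx
  have ht' : t ∈ Icc 0 T := ⟨ht.1, ht.2.le⟩
  rw [hW.eqOn_physVel_pathAcc_klOp hs hP ht hv hxK, fromTorus_klOp_eq hL (isSmooth_torusRep hv) hxK]
  have heqK : EqOn (fromTorus L (torusRep L (pathVel L G t))) (pathVel L G t) 𝕂 := fun y hy =>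
    fromTorus_torusRep_of_mem_K hL hv.periodic hy
  have hQ : helmholtzProj L (toCell L (fromTorus L (torusRep L (pathVel L G t)))) = 0 := by
    rw [toCell_congr fun y hy => heqK (subset_closure (cylinderCell_le_unitCylinder L hy)),
      ← hW.cellRestrict_eq_toCell_pathVel (by omega) ht']
    exact hP.grad_free t ht'
  have hler := lerayPart_eqOn_of_helmholtzProj_eq_zero hL (isSmoothPeriodic_fromTorus hL.ne' (isSmooth_torusRep hv)) hQ hxK
  have hev : fromTorus L (torusRep L (pathVel L G t)) =ᶠ[𝓝 x] pathVel L G t := by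
    filter_upwards [unitCylinder.isOpen.mem_nhds hx] with y hy
    exact heqK (subset_closure hy)
  rw [hler, heqK hxK, hev.fderiv_eq]
  rfl

/-- **The velocity is divergence free and tangential** at times where it is smooth on the closed
cylinder (its cell class has no gradient part). [cite: KatoLai1984, §5 (p. 23)] -/
theorem IsWindowed.divergence_pathVel_eq_zero (hs : 2 ≤ s) {ρ : ℝ} (hP : IsCellPath hL ρ T fun t => cellRestrict hL (G t))
    {t : ℝ} (ht : t ∈ Icc 0 T) (hv : IsSmoothPeriodic L (pathVel L G t)) :
    (∀ x ∈ (unitCylinder : Set ℝ³), VectorCalculus.divergence (pathVel L G t) x = 0) ∧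
      ∀ x ∈ frontier (unitCylinder : Set ℝ³), ⟪pathVel L G t x, eR x⟫_ℝ = 0 := by
  have hQ : helmholtzProj L (toCell L (pathVel L G t)) = 0 := by
    rw [← hW.cellRestrict_eq_toCell_pathVel hs ht]; exact hP.grad_free t ht
  exact ⟨divergence_eq_zero_of_helmholtzProj_eq_zero hL hv hQ, slip_of_helmholtzProj_eq_zero hL hv hQ⟩

end Ident

end PeriodicCylinder

end Literature.Analysis.FluidPDE
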